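import Mathlib
import HarnessLib
import Summits.ValiantsHypothesis.ValiantsHypothesis.Theorems.EquivariantDialLayersQuadricTypes
import Summits.ValiantsHypothesis.ValiantsHypothesis.Theorems.EquivariantDialLayersSpechtDepth

/-!
# Equivariant dial layers — the first superlinear rung: `(m-1)·m(m-3)/2 ≤ idealWidth per_m` at degree `2`

Support file B2 of the decomposition workshop's node O-L1-13 (lineage `decomp-val-lens-1`,
representation-theoretic obstruction splitting) for the cell `EqHardBiPerm`
(`stmt-ValiantsHypothesis-23702`; leaf `EquivariantDialLayers.IdealWidthSuperpoly biPermSubst`).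

HONEST SCOPE.  This is a CUBIC lower bound, at the single degree `d = 2`, for `m = p·q` with `p, q ≥ 3`
(`216 > 81 = m²` at `m = 9`, the first value above the evaluation ceiling `m²` of the earlier rungs).  It says
nothing super-polynomial: `VP ≠ VNP`, the cell `EqHardBiPerm` and the leaf `IdealWidthSuperpoly biPermSubst`
are UNTOUCHED, and no statement about them is made or implied.

THE ARGUMENT ([I3] of the node).  Let `s` be a window-stable (`𝔖_m × 𝔖_m`-stable) finite set of quadrics with
`per_m ∈ (s)`.  By the block witness (`EquivariantDialLayersBlockWitness.perPoly_fin_mul_not_mem_cheapIdeal`,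
`m = pq`) some `f ∈ s` lies outside the cheap ideal `𝔠`; `W = span s` is a `ℂ[𝔖_m × 𝔖_m]`-module and
`f = ∑_χ P_χ f` (isotypic projectors), so some `P_χ f ∉ 𝔠`, `χ = χ^λ ⊠ χ^μ`.  The type of `χ` is pinned down by
the earlier files:
* `λ` or `μ` of depth `≥ 3` is impossible — `P_χ` kills every quadric (file A, `EquivariantDialLayersQuadricTypes`);
* `λ = (m)` or `μ = (m)` is impossible — `P_χ f` is a full row/column symmetrisation, inside `𝔠`
  (`EquivariantDialLayersSymmetrisers`);
* `λ = μ = (m-1,1)` is impossible — `P_χ f` is the `(#fix-1)⊠(#fix-1)`-weighted double sum, inside `𝔠`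
  (`EquivariantDialLayersStabilisers`, with `χ^{(m-1,1)} = #fix - 1` from `SymmetricGroupHookCharacters`);
* hence `{λ, μ} ∋` a partition of depth `2` and the other of depth `1` or `2`, and
  `f^λ f^μ ≤ dim W_χ ≤ dim W ≤ #s` (Serre §2.6) with `f^{(m-1,1)} ≥ m - 1`, `2 f^{(m-2,2)}, 2 f^{(m-2,1,1)} ≥ m(m-3)`
  (file B1, `EquivariantDialLayersSpechtDepth`) gives `(m-1) · m(m-3)/2 ≤ #s`.

Main results: `mul_le_of_not_mem_cheapIdeal` (any `m ≥ 5` with `per_m ∉ 𝔠_m`), ★★★ `mul_le_of_hasIdealWidthLE_two`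
(`m = pq`), `mul_le_idealWidth_two`, `le_idealWidth_two_nine` (`216 ≤ idealWidth (biPermSubst 9) per_9 2`, under the
usual non-emptiness hypothesis of the `sInf`).

References: [cite: SerreLinearRepresentations1977, §2.6 Thm. 8]; [cite: JamesLiebeck2001, 29.13];
[cite: JamesLNM682, §9]; [cite: FultonHarrisGTM129, Theorem 4.3].
-/

set_option linter.dupNamespace false

namespace Summit.ValiantsHypothesis.ValiantsHypothesis.Theorems.EquivariantDialLayersSuperlinear

open MvPolynomial Matrix Literature.Computability.AlgebraicComplexity
open Literature.RepresentationTheory.FiniteGroups Literature.NumberTheory.DiophantineGeometry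
open Summit.ValiantsHypothesis.ValiantsHypothesis.Theorems.EquivariantDialNode
open Summit.ValiantsHypothesis.ValiantsHypothesis.Theorems.EquivariantDialLayers
open Summit.ValiantsHypothesis.ValiantsHypothesis.Theorems.EquivariantDialLayersCharacters
open Summit.ValiantsHypothesis.ValiantsHypothesis.Theorems.EquivariantDialLayersSpecht
open Summit.ValiantsHypothesis.ValiantsHypothesis.Theorems.EquivariantDialLayersBlockWitness
open Summit.ValiantsHypothesis.ValiantsHypothesis.Theorems.EquivariantDialLayersSymmetrisers
open Summit.ValiantsHypothesis.ValiantsHypothesis.Theorems.EquivariantDialLayersStabilisers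
open Summit.ValiantsHypothesis.ValiantsHypothesis.Theorems.EquivariantDialLayersQuadricTypes
open Summit.ValiantsHypothesis.ValiantsHypothesis.Theorems.EquivariantDialLayersSpechtDepth
open Equiv (Perm)

section Abstract

variable {m : ℕ} {V : Type} [AddCommGroup V] [Module ℂ V] [FiniteDimensional ℂ V]
  (ρ : Representation ℂ (Perm (Fin m) × Perm (Fin m)) V)

/-- `f^λ f^μ ≤ dim V` as soon as `P_χ v ≠ 0` for an irreducible character `χ` equal to `χ^λ ⊠ χ^μ`
(`V_χ = range P_χ ∋ P_χ v ≠ 0` and `dim V_χ = χ(1) · (multiplicity)`; the dimension half of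
`EquivariantDialLayersSquare.exists_boxProd_isotypicProj_ne_zero`). [cite: SerreLinearRepresentations1977, §2.6 Thm. 8] -/
theorem mul_numStandardTableaux_le_finrank_of_eq {χ : Perm (Fin m) × Perm (Fin m) → ℂ} {la mu : Nat.Partition m}
    (hχ : IsIrrChar (Perm (Fin m) × Perm (Fin m)) χ)
    (hχt : ∀ t : Perm (Fin m) × Perm (Fin m), χ t = spechtCharacter ℂ la t.1 * spechtCharacter ℂ mu t.2)
    {v : V} (h : isotypicProj ρ χ v ≠ 0) :
    numStandardTableaux la * numStandardTableaux mu ≤ Module.finrank ℂ V := by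
  classical
  obtain ⟨W, _, _, _, τ, hτ, hτχ⟩ := hχ
  haveI := hτ
  have hdim := finrank_range_isotypicProj_eq_mul_finrank_intertwiningMap ρ τ
  rw [hτχ] at hdim
  have hdimN : Module.finrank ℂ ↥(LinearMap.range (isotypicProj ρ χ)) =
      Module.finrank ℂ W * Module.finrank ℂ (Representation.IntertwiningMap τ ρ) := by exact_mod_cast hdim
  have hW : Module.finrank ℂ W = numStandardTableaux la * numStandardTableaux mu := by
    have h1 := Representation.char_one τ
    rw [hτχ, hχt, Prod.fst_one, Prod.snd_one, spechtCharacter_one_eq_numStandardTableaux,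
      spechtCharacter_one_eq_numStandardTableaux] at h1
    exact_mod_cast h1.symm
  have hpos : Module.finrank ℂ ↥(ℂ ∙ isotypicProj ρ χ v) ≤ Module.finrank ℂ ↥(LinearMap.range (isotypicProj ρ χ)) :=
    Submodule.finrank_mono ((Submodule.span_singleton_le_iff_mem _ _).2 (LinearMap.mem_range_self _ _))
  rw [finrank_span_singleton h] at hpos
  have hk : 0 < Module.finrank ℂ (Representation.IntertwiningMap τ ρ) :=
    Nat.pos_of_ne_zero fun hk => by rw [hk, mul_zero] at hdimN; omega
  calc numStandardTableaux la * numStandardTableaux mu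
      ≤ Module.finrank ℂ ↥(LinearMap.range (isotypicProj ρ χ)) := by
        rw [hdimN, ← hW]; exact Nat.le_mul_of_pos_right _ hk
    _ ≤ Module.finrank ℂ V := Submodule.finrank_le _

/-- `f^λ f^μ ≤ dim V` as soon as `P_{χ^λ ⊠ χ^μ} v ≠ 0` for some `v`. [cite: SerreLinearRepresentations1977, §2.6 Thm. 8] -/
theorem mul_numStandardTableaux_le_finrank {la mu : Nat.Partition m} {v : V}
    (h : isotypicProj ρ (fun t => spechtCharacter ℂ la t.1 * spechtCharacter ℂ mu t.2) v ≠ 0) :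
    numStandardTableaux la * numStandardTableaux mu ≤ Module.finrank ℂ V :=
  mul_numStandardTableaux_le_finrank_of_eq ρ ((isIrrChar_spechtCharacter la).boxProd (isIrrChar_spechtCharacter mu))
    (fun _ => rfl) h

end Abstract

/-- `2(m-1) ≤ m(m-3)` for `m ≥ 5` (so `m - 1 ≤ m(m-3)/2 ≤ f^{(m-2,2)}, f^{(m-2,1,1)}`). [folklore] -/
theorem two_mul_sub_one_le {m : ℕ} (hm : 5 ≤ m) : 2 * (m - 1) ≤ m * (m - 3) := by
  obtain ⟨k, rfl⟩ : ∃ k, m = k + 5 := ⟨m - 5, by omega⟩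
  rw [show k + 5 - 1 = k + 4 from by omega, show k + 5 - 3 = k + 2 from by omega]
  nlinarith

/-- **The rung, abstract in `m`.**  For `m ≥ 5`, IF `per_m ∉ 𝔠_m` then every window-stable degree-`2` cut of
`per_m` by `r` quadrics has `(m-1) · m(m-3)/2 ≤ r`: a cut form `f ∉ 𝔠` has an isotypic component `P_χ f ∉ 𝔠`,
whose type `χ = χ^λ ⊠ χ^μ` is neither of depth `≥ 3` (file A), nor row/column-trivial (symmetrisers), nor
`(m-1,1) ⊠ (m-1,1)` (stabilisers); the remaining types have `f^λ f^μ ≥ (m-1) · m(m-3)/2` (file B1) and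
`f^λ f^μ ≤ dim (span s) ≤ r`.  A cubic bound at degree `2`; nothing super-polynomial. [this file] -/
theorem mul_le_of_not_mem_cheapIdeal {m r : ℕ} (hm : 5 ≤ m) (hper : perPoly (Fin m) ℂ ∉ cheapIdeal (Fin m))
    (h : HasIdealWidthLE (biPermSubst m) (perPoly (Fin m) ℂ) 2 r) :
    (m - 1) * (m * (m - 3) / 2) ≤ r := by
  classical
  obtain ⟨s, hcard, hhom, hstab, hmem⟩ := h
  -- a cut form outside the cheap ideal
  obtain ⟨f, hf, hf𝔠⟩ : ∃ f ∈ s, f ∉ cheapIdeal (Fin m) := by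
    by_contra hall
    push Not at hall
    exact hper ((Ideal.span_le.2 fun g hg => hall g hg) hmem)
  -- `W = span s` is a `𝔖_m × 𝔖_m`-module (window-stability), as in `EquivariantDialLayersSpecht`
  set W : Submodule ℂ (MvPolynomial (Fin m × Fin m) ℂ) :=
    Submodule.span ℂ (s : Set (MvPolynomial (Fin m × Fin m) ℂ))
  haveI : FiniteDimensional ℂ W := FiniteDimensional.span_finset ℂ s
  have hW : ∀ (g : Perm (Fin m) × Perm (Fin m)) (w : MvPolynomial (Fin m × Fin m) ℂ),
      w ∈ W → (rename (Equiv.prodCongr g.1 g.2)).toLinearMap w ∈ W := fun g w hw =>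
    (Submodule.map_span_le _ _ _).2 (fun p hp => rename_prodCongr_mem_span hstab g.1 g.2 hp) (Submodule.mem_map_of_mem hw)
  have hcomp : ∀ a b : Perm (Fin m) × Perm (Fin m), (⇑(Equiv.prodCongr a.1 a.2) ∘ ⇑(Equiv.prodCongr b.1 b.2) :
      Fin m × Fin m → Fin m × Fin m) = ⇑(Equiv.prodCongr (a * b).1 (a * b).2) :=
    fun a b => funext fun ⟨i, j⟩ => rfl
  have hid : (⇑(Equiv.prodCongr (1 : Perm (Fin m) × Perm (Fin m)).1 (1 : Perm (Fin m) × Perm (Fin m)).2) :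
      Fin m × Fin m → Fin m × Fin m) = id := funext fun ⟨i, j⟩ => rfl
  let ρ : Representation ℂ (Perm (Fin m) × Perm (Fin m)) W :=
    { toFun := fun g => ((rename (Equiv.prodCongr g.1 g.2)).toLinearMap).restrict (hW g)
      map_one' := LinearMap.ext fun w => Subtype.ext (by
        simp only [LinearMap.coe_restrict_apply, AlgHom.toLinearMap_apply, Module.End.one_apply, hid, rename_id_apply])
      map_mul' := fun a b => LinearMap.ext fun w => Subtype.ext (by
        simp only [LinearMap.coe_restrict_apply, AlgHom.toLinearMap_apply, Module.End.mul_apply, rename_rename, hcomp]) }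
  have hρ : ∀ (g : Perm (Fin m) × Perm (Fin m)) (x : W), ((ρ g x : W) : MvPolynomial (Fin m × Fin m) ℂ) =
      rename (Equiv.prodCongr g.1 g.2) (x : MvPolynomial (Fin m × Fin m) ℂ) := fun _ _ => rfl
  have hfW : f ∈ W := Submodule.subset_span hf
  -- some isotypic component of `f` escapes `𝔠` (`f = ∑_χ P_χ f`)
  obtain ⟨χ, hχT, hPχ⟩ : ∃ χ ∈ (irrChars_finite_holds (Perm (Fin m) × Perm (Fin m))).toFinset,
      ((isotypicProj ρ χ ⟨f, hfW⟩ : W) : MvPolynomial (Fin m × Fin m) ℂ) ∉ cheapIdeal (Fin m) := by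
    by_contra hall
    push Not at hall
    apply hf𝔠
    have key := congrArg Subtype.val (sum_isotypicProj_apply ρ ⟨f, hfW⟩)
    rw [Submodule.coe_sum] at key
    change ((⟨f, hfW⟩ : W) : MvPolynomial (Fin m × Fin m) ℂ) ∈ cheapIdeal (Fin m)
    rw [← key]
    exact Ideal.sum_mem _ fun χ hχ => hall χ hχ
  have hχ : χ ∈ irrChars (Perm (Fin m) × Perm (Fin m)) := (irrChars_finite_holds _).mem_toFinset.mp hχT
  have hχi : IsIrrChar (Perm (Fin m) × Perm (Fin m)) χ := hχ
  obtain ⟨ψ, hψ, φ, hφ, hχeq⟩ := exists_eq_boxProd_of_mem_irrChars hχ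
  rw [irrChars_perm_eq] at hψ hφ
  obtain ⟨la, rfl⟩ := hψ
  obtain ⟨mu, rfl⟩ := hφ
  have hχt : ∀ t : Perm (Fin m) × Perm (Fin m), χ t = spechtCharacter ℂ la t.1 * spechtCharacter ℂ mu t.2 :=
    fun t => by rw [hχeq]
  -- the component, in `W` and as a polynomial
  have hPW : isotypicProj ρ χ ⟨f, hfW⟩ = ∑ t : Perm (Fin m) × Perm (Fin m),
      (χ 1 / Fintype.card (Perm (Fin m) × Perm (Fin m)) * (spechtCharacter ℂ la t.1 * spechtCharacter ℂ mu t.2)) •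
        ρ t⁻¹ ⟨f, hfW⟩ := by
    rw [isotypicProj_apply]
    exact Finset.sum_congr rfl fun t _ => by rw [hχt t]
  have hcoe : ((isotypicProj ρ χ ⟨f, hfW⟩ : W) : MvPolynomial (Fin m × Fin m) ℂ) =
      ∑ t : Perm (Fin m) × Perm (Fin m),
        (χ 1 / Fintype.card (Perm (Fin m) × Perm (Fin m)) * (spechtCharacter ℂ la t.1 * spechtCharacter ℂ mu t.2)) •
          rename (Equiv.prodCongr t.1⁻¹ t.2⁻¹) f := by
    rw [hPW, Submodule.coe_sum]
    exact Finset.sum_congr rfl fun t _ => by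
      simp only [Submodule.coe_smul, hρ, Prod.fst_inv, Prod.snd_inv]
  -- (1) types of depth `≥ 3` are absent from the quadrics (file A)
  by_cases hdeep : m ≤ la.sortedParts.getD 0 0 + 2 ∧ m ≤ mu.sortedParts.getD 0 0 + 2
  swap
  · refine absurd ?_ hPχ
    rw [hcoe, sum_mul_smul_eq, sum_boxProd_smul_rename_eq_zero (by omega) hdeep (hhom f hf), smul_zero]
    exact Submodule.zero_mem _
  obtain ⟨hla2, hmu2⟩ := hdeep
  have hla0 := getD_sortedParts_zero_le la
  have hmu0 := getD_sortedParts_zero_le mu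
  -- (2) `λ = (m)`: `P_χ f` is a twisted full ROW symmetrisation of `f`, inside `𝔠`
  by_cases hlam : la.sortedParts.getD 0 0 = m
  · refine absurd ?_ hPχ
    have h1 : ∀ σ : Perm (Fin m), spechtCharacter ℂ la σ = 1 :=
      spechtCharacter_eq_one_of_card_parts_le_one la (card_parts_le_one_of_getD la hlam)
    rw [hPW, sum_boxProd_smul_eq_row ρ _ _ (spechtCharacter ℂ la) (spechtCharacter ℂ mu)]
    simp only [h1, one_smul, Submodule.coe_sum, Submodule.coe_smul, hρ]
    refine Ideal.sum_mem _ fun τ _ => Submodule.smul_of_tower_mem _ _ (rename_prodCongr_mem_cheapIdeal _ _ ?_)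
    have hre : ∑ σ : Perm (Fin m), rename (Equiv.prodCongr σ⁻¹ (1 : Perm (Fin m))) f =
        ∑ σ : Perm (Fin m), rename (Equiv.prodCongr σ (1 : Perm (Fin m))) f := by
      refine Fintype.sum_equiv (Equiv.inv (Perm (Fin m))) _ _ fun σ => ?_
      rfl
    rw [hre]
    exact rowSym_mem_cheapIdeal (hhom f hf)
  -- (3) `μ = (m)`: a twisted full COLUMN symmetrisation, inside `𝔠`
  by_cases hmum : mu.sortedParts.getD 0 0 = m
  · refine absurd ?_ hPχ
    have h1 : ∀ τ : Perm (Fin m), spechtCharacter ℂ mu τ = 1 :=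
      spechtCharacter_eq_one_of_card_parts_le_one mu (card_parts_le_one_of_getD mu hmum)
    rw [hPW, sum_boxProd_smul_eq_col ρ _ _ (spechtCharacter ℂ la) (spechtCharacter ℂ mu)]
    simp only [h1, one_smul, Submodule.coe_sum, Submodule.coe_smul, hρ]
    refine Ideal.sum_mem _ fun σ _ => Submodule.smul_of_tower_mem _ _ (rename_prodCongr_mem_cheapIdeal _ _ ?_)
    have hre : ∑ τ : Perm (Fin m), rename (Equiv.prodCongr (1 : Perm (Fin m)) τ⁻¹) f =
        ∑ τ : Perm (Fin m), rename (Equiv.prodCongr (1 : Perm (Fin m)) τ) f := by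
      refine Fintype.sum_equiv (Equiv.inv (Perm (Fin m))) _ _ fun τ => ?_
      rfl
    rw [hre]
    exact colSym_mem_cheapIdeal (hhom f hf)
  -- (4) `λ = μ = (m-1,1)`: the `(#fix-1) ⊠ (#fix-1)`-weighted double sum, inside `𝔠`
  by_cases hSS : la.sortedParts.getD 0 0 + 1 = m ∧ mu.sortedParts.getD 0 0 + 1 = m
  · refine absurd ?_ hPχ
    have hS1 := spechtCharacter_of_sortedParts_eq_hook la (by omega) (sortedParts_eq_of_getD la hSS.1)
    have hS2 := spechtCharacter_of_sortedParts_eq_hook mu (by omega) (sortedParts_eq_of_getD mu hSS.2)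
    rw [hcoe]
    simp only [hS1, hS2]
    rw [sum_mul_smul_eq]
    exact Submodule.smul_of_tower_mem _ _ (sum_fixedCard_smul_rename_inv_mem_cheapIdeal (hhom f hf))
  -- (5) the remaining types: `{λ, μ} ⊆ {(m-1,1), (m-2,2), (m-2,1,1)}`, not both `(m-1,1)`; count dimensions
  have hPne : isotypicProj ρ χ ⟨f, hfW⟩ ≠ 0 := fun h0 => hPχ (by rw [h0, Submodule.coe_zero]; exact Submodule.zero_mem _)
  have hdim := mul_numStandardTableaux_le_finrank_of_eq ρ hχi hχt hPne
  have hr : numStandardTableaux la * numStandardTableaux mu ≤ r :=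
    hdim.trans ((finrank_span_finset_le_card (R := ℂ) s).trans hcard)
  have h2m := two_mul_sub_one_le hm
  rcases Nat.lt_or_ge (mu.sortedParts.getD 0 0 + 1) m with hmuP | hmuS
  · -- `μ` of depth `2`, `λ` of depth `1` or `2`
    have hfmu := mul_le_two_mul_numStandardTableaux_of_getD (by omega) mu (by omega)
    have hfla : m - 1 ≤ numStandardTableaux la := by
      rcases Nat.lt_or_ge (la.sortedParts.getD 0 0 + 1) m with hlaP | hlaS
      · have := mul_le_two_mul_numStandardTableaux_of_getD (by omega) la (by omega)
        omega
      · exact sub_one_le_numStandardTableaux_of_getD la (by omega)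
    calc (m - 1) * (m * (m - 3) / 2) ≤ numStandardTableaux la * numStandardTableaux mu :=
          Nat.mul_le_mul hfla (by omega)
      _ ≤ r := hr
  · -- `μ = (m-1,1)`, hence `λ` of depth `2`
    have hfmu := sub_one_le_numStandardTableaux_of_getD mu (by omega)
    have hfla := mul_le_two_mul_numStandardTableaux_of_getD (by omega) la (by omega)
    calc (m - 1) * (m * (m - 3) / 2) = (m * (m - 3) / 2) * (m - 1) := Nat.mul_comm _ _
      _ ≤ numStandardTableaux la * numStandardTableaux mu := Nat.mul_le_mul (by omega) hfmu
      _ ≤ r := hr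

/-- ★★★ [I3] **FIRST SUPERLINEAR RUNG.**  For `m = pq`, `p, q ≥ 3`, every window-stable degree-`2` cut of `per_m` by
`r` quadrics has `(m-1) · m(m-3)/2 ≤ r` (`= 216 > 81 = m²` at `m = 9`).  RIDER: a cubic lower bound at degree `2`
for `m = pq`; it says nothing super-polynomial; `VP ≠ VNP`, `EqHardBiPerm`, `IdealWidthSuperpoly` untouched.
[this file] -/
theorem mul_le_of_hasIdealWidthLE_two {p q r : ℕ} (hp : 3 ≤ p) (hq : 3 ≤ q)
    (h : HasIdealWidthLE (biPermSubst (p * q)) (perPoly (Fin (p * q)) ℂ) 2 r) :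
    (p * q - 1) * (p * q * (p * q - 3) / 2) ≤ r :=
  mul_le_of_not_mem_cheapIdeal (le_trans (by norm_num) (Nat.mul_le_mul hp hq))
    (perPoly_fin_mul_not_mem_cheapIdeal hp hq) h

/-- The rung on the leaf's width: `(m-1)·m(m-3)/2 ≤ idealWidth (biPermSubst m) per_m 2` for `m = pq`, `p, q ≥ 3`
(wherever a degree-2 window-stable cut exists; same rider: cubic at `d = 2`, nothing super-polynomial). [this file] -/
theorem mul_le_idealWidth_two {p q : ℕ} (hp : 3 ≤ p) (hq : 3 ≤ q)
    (hne : ∃ r, HasIdealWidthLE (biPermSubst (p * q)) (perPoly (Fin (p * q)) ℂ) 2 r) :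
    (p * q - 1) * (p * q * (p * q - 3) / 2) ≤ idealWidth (biPermSubst (p * q)) (perPoly (Fin (p * q)) ℂ) 2 := by
  obtain ⟨r, hr⟩ := hne
  unfold idealWidth
  exact le_csInf ⟨r, hr⟩ fun r' hr' => mul_le_of_hasIdealWidthLE_two hp hq hr'

/-- `m = 9`: `216 ≤ idealWidth (biPermSubst 9) per_9 2`, above the evaluation ceiling `m² = 81` (same rider). [this file] -/
theorem le_idealWidth_two_nine (hne : ∃ r, HasIdealWidthLE (biPermSubst 9) (perPoly (Fin 9) ℂ) 2 r) :
    216 ≤ idealWidth (biPermSubst 9) (perPoly (Fin 9) ℂ) 2 :=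
  mul_le_idealWidth_two (p := 3) (q := 3) le_rfl le_rfl hne

end Summit.ValiantsHypothesis.ValiantsHypothesis.Theorems.EquivariantDialLayersSuperlinear
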